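import Summits.BirchSwinnertonDyer.BirchSwinnertonDyer.Theorems.ClassRecordThreeCornerAtThreeShimuraWalkEndGlue
import HarnessLib

/-!
# END GLUE of the (DIV) port, level-supply half, in GROSS currency: `ShimuraWalk.LevelSupplyAt` ⟸ the family-datum per-level inequality
# over Gross conductors (cell `bsd-stepL`, seat `bsd-stepL-tam3-p1` g13, owner of 19109's line; `--supports stmt-BirchSwinnertonDyer-19109 --as helper`)

WHY. corner3-p2 g8's `ShimuraWalk.levelSupplyAt_of_familyLevelSupply` (p598543) keys its hypothesis `hlevF` on ZHANG admissibility
(`Zhang2014.IsKolyvaginPrime ∧ k ≤ M(q)`, `Zhang2014.levelIndex`) because this seat's first engine (`…_family`, p595546) was Zhang-keyed;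
but every family-side PRODUCER of lane B (`…ShimuraFamilyKummerPlaces`, `…ShimuraFamilySign`, the carrier) is GROSS-keyed
(`IsKolyvaginPrime ∧ FrobEqFrobInfty (p^M)`), and Zhang depth does not imply Gross depth. This seat's (P2) assembly
`Koly.familyLevelSupply_of_memberships` (`…KolyvaginFamilyLevelSupply`) therefore concludes the GROSS reading `hlevG`; THIS FILE is the
matching glue (the Zhang version's proof with its last step removed). HONEST FRAMING: one theorem, no definition ∕ fact ∕ sorry;
CONDITIONAL on `hlevG` + weak (B4); nothing about any curve; no stub closes; BSD is not proved by any of this; T7. Credit: corner3-p2 g8.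
References: [cite: Jetchev2008, Thm. 1.4 (p. 812), §6] [cite: GrossLMS1991, §3 (3.2)–(3.3)] [cite: WZhang2014, Notations (xii)].
presearch: not applicable (glue between tree currencies); `lean search 'of_familyLevelSupplyGross'` → none.
-/

set_option autoImplicit false
set_option linter.dupNamespace false

noncomputable section

open scoped Classical

namespace Summit.BirchSwinnertonDyer.BirchSwinnertonDyer.Theorems.ShimuraWalk

open WeierstrassCurve Field NumberField IsDedekindDomain Finset
  Literature.NumberTheory.EllipticCurves Literature.NumberTheory.GaloisRepresentations
  Literature.NumberTheory.EllipticCurves.KolyvaginCocycle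
  Literature.NumberTheory.EllipticCurves.KolyvaginEuler
  Literature.NumberTheory.EllipticCurves.RingClassField
  Literature.NumberTheory.EllipticCurves.ModularForms
  Summit.BirchSwinnertonDyer.Rank1Residual.X11b
  Summit.BirchSwinnertonDyer.Rank1Residual.JET
  Summit.BirchSwinnertonDyer.BirchSwinnertonDyer.Theorems

variable {K : Type} [Field K] [NumberField K] {W : WeierstrassCurve ℚ}

/-- **Level-supply glue, GROSS currency**: `LevelSupplyAt hK ι W N_E p ys t` from the family-datum per-level inequality `hlevG` stated over
GROSS conductors and the GROSS level index (`frobLevelIndex`) — corner3-p2 g8's `levelSupplyAt_of_familyLevelSupply` (p598543) with the Zhang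
step removed (`hlevG` is exactly the conclusion of this seat's `Koly.familyLevelSupply_of_memberships`). Bookkeeping verbatim otherwise:
`m(c) < k` forces `m′(c) = μ₀ < k`, and at depth `k + μ₀ ≤ M_Gross(c)` the dictionary (`min_mdiv_eq_min_divOrd`) gives `ord_p(P_c) = μ₀` for
the datum populated from `ys`. [cite: Jetchev2008, Thm. 1.4 (p. 812)] [cite: GrossLMS1991, §3 (3.2)–(3.3)] -/
theorem levelSupplyAt_of_familyLevelSupplyGross (hK : IsImaginaryQuadratic K) (ι : K →+* ℂ)
    [W.IsElliptic] [W.IsGloballyMinimal] [NeZero (W.conductorNorm ℤ)]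
    (Dt : ModularParametrizationData W (W.conductorNorm ℤ)) {p : ℕ} (hp : p.Prime)
    (ys : (m : ℕ) → (W.baseChange (ringClassField K ι m)).toAffine.Point) (t : ℕ)
    (hB4 : ∀ k : ℕ, Squarefree k → (∀ q ∈ k.primeFactors, IsKolyvaginPrime (W.conductorNorm ℤ) W K p q) →
      ∀ ℓ ∈ k.primeFactors, ∀ σ : ringClassField K ι k ≃ₐ[ℚ] ringClassField K ι k,
      Subgroup.zpowers σ = ringClassGalOver ι k (k / ℓ) →
      ∃ y' : (W.baseChange (ringClassField K ι k)).toAffine.Point,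
        ∑ i ∈ Finset.range (ℓ + 1), pointGalHom W (ringClassField K ι k) (σ ^ i) (ys k) =
          W.frobeniusTrace ℓ • y')
    (hlevG : ∀ (k n : ℕ) (d : KolyvaginFamilyData W K ι n), d.y = ys n → Squarefree n →
      (∀ ℓ ∈ n.primeFactors, IsKolyvaginPrime (W.conductorNorm ℤ) W K p ℓ) →
      (if d.divOrd p < frobLevelIndex W K p n then d.divOrd p else (⊤ : ℕ∞)) < (k : ℕ∞) → t ≤ k →
      (k : ℕ∞) + (if d.divOrd p < frobLevelIndex W K p n then d.divOrd p else ⊤) ≤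
        frobLevelIndex W K p n →
      (t : ℕ∞) ≤ (if d.divOrd p < frobLevelIndex W K p n then d.divOrd p else ⊤)) :
    LevelSupplyAt hK ι W (W.conductorNorm ℤ) p ys t := by
  intro k c h0 htk hMc
  -- `m(c) < k` forces `m′(c) < M_Gross(c)` and `m′(c) = μ₀ < k`
  have hlt : mdiv hK ι W ys p c.1 < frobLevelIndex W K p c.1 := by
    by_contra h
    rw [if_neg h] at h0
    exact absurd h0 (not_lt_of_ge le_top)
  rw [if_pos hlt] at h0 hMc ⊢
  have hne : mdiv hK ι W ys p c.1 ≠ ⊤ := ne_top_of_lt hlt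
  set μ₀ : ℕ := (mdiv hK ι W ys p c.1).toNat with hμ₀def
  have hμ₀ : mdiv hK ι W ys p c.1 = (μ₀ : ℕ∞) := (ENat.coe_toNat hne).symm
  rw [hμ₀] at h0 hMc hlt ⊢
  have hμ₀k : μ₀ < k := by exact_mod_cast h0
  have hk1 : 1 ≤ k := by omega
  -- the depth `M := k + μ₀ ≤ M_Gross(c)`
  have hM : ((k + μ₀ : ℕ) : ℕ∞) ≤ frobLevelIndex W K p c.1 := by push_cast; exact hMc
  have hkol : ∀ q ∈ c.1.primeFactors, IsKolyvaginPrime (W.conductorNorm ℤ) W K p q ∧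
      FrobEqFrobInfty W K (p ^ (k + μ₀)) q :=
    fun q hq ↦ ⟨c.2.2 q hq, (natCast_le_frobLevelIndex_iff c.2.2 (k + μ₀)).mp hM q hq⟩
  -- the datum populated from `ys`, and the dictionary at depth `k + μ₀`
  obtain ⟨d, hd⟩ := exists_familyData_y_eq (W := W) hK ι c.2.1 (fun q hq ↦ (c.2.2 q hq).2.2.2.2.1) ys
  have hdict := min_mdiv_eq_min_divOrd hK ι Dt hp (by omega : 1 ≤ k + μ₀) c.2.1 hkol ys d hd
    (hB4 c.1 c.2.1 (fun q hq ↦ c.2.2 q hq))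
  have hμ₀M : (μ₀ : ℕ∞) < ((k + μ₀ : ℕ) : ℕ∞) := by exact_mod_cast (by omega : μ₀ < k + μ₀)
  rw [hμ₀, min_eq_right hμ₀M.le] at hdict
  have hdiv : d.divOrd p = (μ₀ : ℕ∞) := eq_of_min_eq_of_lt hdict.symm hμ₀M
  -- Gross side, no Zhang step
  have hltG : d.divOrd p < frobLevelIndex W K p c.1 := by rw [hdiv]; exact hlt
  have key := hlevG k c.1 d hd c.2.1 (fun q hq ↦ c.2.2 q hq) (by rw [if_pos hltG, hdiv]; exact_mod_cast hμ₀k) htk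
    (by rw [if_pos hltG, hdiv]; exact hMc)
  rwa [if_pos hltG, hdiv] at key

end Summit.BirchSwinnertonDyer.BirchSwinnertonDyer.Theorems.ShimuraWalk

end
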